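import Literature.NumberTheory.Sieve.MoebiusExpSumDavenport

/-!
# Route `GreenTaoLevelTwo`, crux `MNTwo` (stmt-Parity-21276), line `birth`, stub `stub_mnVertical`:
# from dyadic blocks `(m, 2m]` to the initial segment `[1, N]`

Brick for block V3 (§8) of the `stub_mnVertical` census (B. Green, T. Tao, *Quadratic uniformity of
the Möbius function*, Ann. Inst. Fourier 58 (2008) = arXiv:math/0606087).  The source proves its
estimates for the dyadic averages `𝔼_{N < n ≤ 2N}` and passes to `𝔼_{n ∈ [N]}` by "decomposing the
interval `{1,…,N}` into `O(log N)` intervals … together with `O(log N)` extra points" (App. A, proof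
of Lemma 35).  Here is that bookkeeping, def-free and with explicit constants, in the form block V3
uses it (halving chain `N, ⌊N/2⌋, ⌊N/4⌋, …`; blocks below `√N` are estimated trivially):

* `sum_Ioc_zero_eq_sum_blocks` — `∑_{0 < n ≤ a₀} f = ∑_{j < J} ∑_{a_{j+1} < n ≤ a_j} f + ∑_{0 < n ≤ a_J} f`
  for any chain `a_{j+1} ≤ a_j`;
* `log_rpow_le_mul_sqrt` — `log^A N ≤ (2A)^A √N` (`A > 0`, `N ≥ 1`);
* `norm_sum_Icc_le_of_dyadic` — if `‖f‖ ≤ 1` and `‖∑_{m < n ≤ 2m} f‖ ≤ C m / log^A m` for all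
  `m ≥ max(2, √N)` with `2m ≤ N`, then `‖∑_{n ≤ N} f‖ ≤ (2^A C + 8 (2A)^A) N / log^A N`.

References: [GreenTao2008QuadraticMobius] arXiv:math/0606087, App. A (proof of Lemma 35).
-/

noncomputable section

open Finset Real

namespace Summit.Parity.GeneralizedHardyLittlewood.GreenTaoLevelTwoMNTwoDyadicToFull

/-- Telescoping a sum over `(0, a₀]` along a chain `a_{j+1} ≤ a_j`. [folklore] -/
theorem sum_Ioc_zero_eq_sum_blocks (f : ℕ → ℂ) (a : ℕ → ℕ) (ha : ∀ j, a (j + 1) ≤ a j) (J : ℕ) :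
    ∑ n ∈ Ioc 0 (a 0), f n =
      ∑ j ∈ range J, ∑ n ∈ Ioc (a (j + 1)) (a j), f n + ∑ n ∈ Ioc 0 (a J), f n := by
  induction J with
  | zero => simp
  | succ J ih =>
    rw [ih, sum_range_succ, add_assoc, add_comm (∑ n ∈ Ioc (a (J + 1)) (a J), f n),
      sum_Ioc_consecutive _ (Nat.zero_le _) (ha J)]

/-- `log^A N ≤ (2A)^A · √N` for `A > 0` and `N ≥ 1` (from `log x ≤ x^ε/ε`). [folklore] -/
theorem log_rpow_le_mul_sqrt {A : ℝ} (hA : 0 < A) {x : ℝ} (hx : 1 ≤ x) :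
    Real.log x ^ A ≤ (2 * A) ^ A * Real.sqrt x := by
  have hx0 : 0 ≤ x := by linarith
  have hlog0 : 0 ≤ Real.log x := Real.log_nonneg hx
  have hε : 0 < 1 / (2 * A) := by positivity
  have h1 : Real.log x ≤ x ^ (1 / (2 * A)) / (1 / (2 * A)) := Real.log_le_rpow_div hx0 hε
  rw [div_div_eq_mul_div, div_one] at h1
  have h2 : Real.log x ^ A ≤ (x ^ (1 / (2 * A)) * (2 * A)) ^ A :=
    Real.rpow_le_rpow hlog0 h1 hA.le
  calc Real.log x ^ A ≤ (x ^ (1 / (2 * A)) * (2 * A)) ^ A := h2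
    _ = (x ^ (1 / (2 * A))) ^ A * (2 * A) ^ A :=
        Real.mul_rpow (Real.rpow_nonneg hx0 _) (by positivity)
    _ = Real.sqrt x * (2 * A) ^ A := by
        rw [← Real.rpow_mul hx0, show 1 / (2 * A) * A = 1 / 2 by field_simp, Real.sqrt_eq_rpow]
    _ = (2 * A) ^ A * Real.sqrt x := mul_comm _ _

/-- **From dyadic blocks to `[1, N]`.**  Let `‖f(n)‖ ≤ 1`, `A > 0`, `C ≥ 0`, `N ≥ 2`, and suppose the
dyadic estimate `‖∑_{m < n ≤ 2m} f(n)‖ ≤ C m / log^A m` holds for every `m` with `2 ≤ m`, `√N ≤ m` and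
`2m ≤ N`.  Then `‖∑_{n=1}^{N} f(n)‖ ≤ (2^A C + 8(2A)^A) N / log^A N`.
[cite: GreenTao2008QuadraticMobius, App. A, proof of Lemma 35 ("decompose `{1,…,N}` into `O(log N)`
intervals … together with `O(log N)` extra points")] -/
theorem norm_sum_Icc_le_of_dyadic {A C : ℝ} (hA : 0 < A) (hC : 0 ≤ C) {N : ℕ} (hN : 2 ≤ N)
    (f : ℕ → ℂ) (hf : ∀ n, ‖f n‖ ≤ 1)
    (hdy : ∀ m : ℕ, 2 ≤ m → Real.sqrt N ≤ m → 2 * m ≤ N →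
      ‖∑ n ∈ Ioc m (2 * m), f n‖ ≤ C * m / Real.log m ^ A) :
    ‖∑ n ∈ Icc 1 N, f n‖ ≤ (2 ^ A * C + 8 * (2 * A) ^ A) * N / Real.log N ^ A := by
  -- notation
  have hNr : (2 : ℝ) ≤ N := by exact_mod_cast hN
  have hN1 : (1 : ℝ) ≤ N := by linarith
  have hNpos : (0 : ℝ) < N := by linarith
  have hlogN : 0 < Real.log N := Real.log_pos (by linarith)
  set L : ℝ := Real.log N ^ A with hL
  have hLpos : 0 < L := Real.rpow_pos_of_pos hlogN A
  set T : ℝ := max 2 (Real.sqrt N) with hT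
  have hT2 : (2 : ℝ) ≤ T := le_max_left _ _
  have hTs : Real.sqrt N ≤ T := le_max_right _ _
  have hTpos : 0 < T := by linarith
  have hsqrt1 : 1 ≤ Real.sqrt N := by rw [show (1:ℝ) = Real.sqrt 1 by simp]; exact Real.sqrt_le_sqrt hN1
  have hTle : T ≤ Real.sqrt N + 2 := max_le (by linarith) (by linarith)
  set U : ℝ := 2 * T + 1 with hU
  -- the halving chain
  set a : ℕ → ℕ := fun j => N / 2 ^ j with ha
  have ha0 : a 0 = N := by simp [ha]
  have hasucc : ∀ j, a (j + 1) = a j / 2 := fun j => by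
    simp only [ha, pow_succ, Nat.div_div_eq_div_mul]
  have hadec : ∀ j, a (j + 1) ≤ a j := fun j => by rw [hasucc]; exact Nat.div_le_self _ _
  have hamod : ∀ j, a j = 2 * a (j + 1) + a j % 2 := fun j => by
    rw [hasucc]; exact (Nat.div_add_mod (a j) 2).symm
  have haN : a N = 0 := by
    simp only [ha]; exact Nat.div_eq_of_lt (Nat.lt_two_pow_self)
  have hareal : ∀ j, (a (j + 1) : ℝ) ≤ N * (1 / 2) ^ (j + 1) := fun j => by
    simp only [ha]
    calc ((N / 2 ^ (j + 1) : ℕ) : ℝ) ≤ (N : ℝ) / ((2 : ℕ) ^ (j + 1) : ℕ) := Nat.cast_div_le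
      _ = N * (1 / 2) ^ (j + 1) := by push_cast; rw [div_eq_mul_inv, ← inv_pow, one_div]
  -- decomposition
  have hdec : ∑ n ∈ Icc 1 N, f n = ∑ j ∈ range N, ∑ n ∈ Ioc (a (j + 1)) (a j), f n := by
    have h := sum_Ioc_zero_eq_sum_blocks f a hadec N
    rw [haN, ha0] at h
    simp only [Ioc_self, sum_empty, add_zero] at h
    rw [← h, show Icc 1 N = Ioc 0 N from Finset.Icc_add_one_left_eq_Ioc 0 N]
  -- block bound
  have hblock : ∀ j, ‖∑ n ∈ Ioc (a (j + 1)) (a j), f n‖ ≤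
      (C * 2 ^ A / L + 1 / T) * (a (j + 1) : ℝ) +
        (min (a j : ℝ) U - min (a (j + 1) : ℝ) U) := by
    intro j
    set m := a (j + 1) with hm
    have hmono : min (m : ℝ) U ≤ min (a j : ℝ) U :=
      min_le_min (by exact_mod_cast hadec j) le_rfl
    have hcoef : 0 ≤ (C * 2 ^ A / L + 1 / T) * (m : ℝ) := by positivity
    -- the block is `(m, 2m]` plus possibly the point `2m+1`
    have hr := Nat.mod_two_eq_zero_or_one (a j)
    have hsplit : ‖∑ n ∈ Ioc m (a j), f n‖ ≤ ‖∑ n ∈ Ioc m (2 * m), f n‖ + 1 := by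
      rcases hr with hr | hr
      · have : a j = 2 * m := by have := hamod j; omega
        rw [this]; linarith [norm_nonneg (∑ n ∈ Ioc m (2 * m), f n)]
      · have : a j = 2 * m + 1 := by have := hamod j; omega
        rw [this, sum_Ioc_succ_top (by omega : m ≤ 2 * m)]
        exact (norm_add_le _ _).trans (by linarith [hf (2 * m + 1)])
    by_cases hbig : T ≤ (m : ℝ)
    · -- big block: dyadic estimate
      have hm2 : 2 ≤ m := by exact_mod_cast hT2.trans hbig
      have hmsqrt : Real.sqrt N ≤ m := hTs.trans hbig
      have h2m : 2 * m ≤ N := by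
        have := hamod j; have h' : a j ≤ N := by
          simp only [ha]; exact Nat.div_le_self _ _
        omega
      have hd := hdy m hm2 hmsqrt h2m
      have hmpos : (0 : ℝ) < m := by exact_mod_cast (show 0 < m by omega)
      -- `log m ≥ (1/2) log N`
      have hlogm : Real.log N / 2 ≤ Real.log m := by
        rw [← Real.log_sqrt hNpos.le]
        exact Real.log_le_log (by positivity) hmsqrt
      have hlogm_pos : 0 < Real.log m := by linarith
      have hLm : L ≤ 2 ^ A * Real.log m ^ A := by
        calc L = (2 * (Real.log N / 2)) ^ A := by rw [hL]; ring_nf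
          _ = 2 ^ A * (Real.log N / 2) ^ A := Real.mul_rpow (by norm_num) (by linarith)
          _ ≤ 2 ^ A * Real.log m ^ A := by
              apply mul_le_mul_of_nonneg_left _ (by positivity)
              exact Real.rpow_le_rpow (by linarith) hlogm hA.le
      have hmA : 0 < Real.log m ^ A := Real.rpow_pos_of_pos hlogm_pos A
      have h1 : C * m / Real.log m ^ A ≤ C * 2 ^ A / L * m := by
        rw [div_le_iff₀ hmA,
          show C * 2 ^ A / L * (m : ℝ) * Real.log m ^ A = C * m * (2 ^ A * Real.log m ^ A) / L by ring,
          le_div_iff₀ hLpos]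
        exact mul_le_mul_of_nonneg_left hLm (by positivity)
      have h2 : (1 : ℝ) ≤ 1 / T * m := by
        rw [one_div, inv_mul_eq_div, le_div_iff₀ hTpos, one_mul]; exact hbig
      calc ‖∑ n ∈ Ioc m (a j), f n‖ ≤ ‖∑ n ∈ Ioc m (2 * m), f n‖ + 1 := hsplit
        _ ≤ C * 2 ^ A / L * m + 1 / T * m := add_le_add (hd.trans h1) h2
        _ = (C * 2 ^ A / L + 1 / T) * (m : ℝ) := by ring
        _ ≤ _ := le_add_of_nonneg_right (by linarith)
    · -- small block: trivial bound, telescoping form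
      push Not at hbig
      have hajU : (a j : ℝ) < U := by
        have := hamod j
        have hr2 : a j % 2 ≤ 1 := by omega
        have : (a j : ℝ) ≤ 2 * m + 1 := by exact_mod_cast (by omega : a j ≤ 2 * m + 1)
        rw [hU]; linarith
      have hmU : (m : ℝ) < U := by rw [hU]; linarith
      rw [min_eq_left hajU.le, min_eq_left hmU.le]
      have htriv : ‖∑ n ∈ Ioc m (a j), f n‖ ≤ (a j : ℝ) - m := by
        calc ‖∑ n ∈ Ioc m (a j), f n‖ ≤ ∑ n ∈ Ioc m (a j), ‖f n‖ := norm_sum_le _ _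
          _ ≤ ∑ n ∈ Ioc m (a j), (1 : ℝ) := sum_le_sum fun n _ => hf n
          _ = (a j : ℝ) - m := by
              simp only [sum_const, Nat.card_Ioc, nsmul_eq_mul, mul_one]
              rw [Nat.cast_sub (hadec j)]
      linarith
  -- summing the block bounds
  have hsumA : ∑ j ∈ range N, (a (j + 1) : ℝ) ≤ N := by
    calc ∑ j ∈ range N, (a (j + 1) : ℝ) ≤ ∑ j ∈ range N, (N : ℝ) * (1 / 2) ^ (j + 1) :=
          sum_le_sum fun j _ => hareal j
      _ = N * (1 / 2) * ∑ j ∈ range N, (1 / 2 : ℝ) ^ j := by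
          rw [mul_sum]; refine sum_congr rfl fun j _ => ?_; ring
      _ ≤ N * (1 / 2) * 2 := by
          apply mul_le_mul_of_nonneg_left (sum_geometric_two_le N) (by positivity)
      _ = N := by ring
  have htel : ∑ j ∈ range N, (min (a j : ℝ) U - min (a (j + 1) : ℝ) U) ≤ U := by
    rw [sum_range_sub' (fun j => min (a j : ℝ) U) N]
    have h1 : min (a 0 : ℝ) U ≤ U := min_le_right _ _
    have h2 : 0 ≤ min (a N : ℝ) U := by rw [haN]; simp; linarith
    linarith
  have htotal : ‖∑ n ∈ Icc 1 N, f n‖ ≤ (C * 2 ^ A / L + 1 / T) * N + U := by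
    rw [hdec]
    calc ‖∑ j ∈ range N, ∑ n ∈ Ioc (a (j + 1)) (a j), f n‖
        ≤ ∑ j ∈ range N, ‖∑ n ∈ Ioc (a (j + 1)) (a j), f n‖ := norm_sum_le _ _
      _ ≤ ∑ j ∈ range N, ((C * 2 ^ A / L + 1 / T) * (a (j + 1) : ℝ) +
            (min (a j : ℝ) U - min (a (j + 1) : ℝ) U)) := sum_le_sum fun j _ => hblock j
      _ = (C * 2 ^ A / L + 1 / T) * ∑ j ∈ range N, (a (j + 1) : ℝ) +
            ∑ j ∈ range N, (min (a j : ℝ) U - min (a (j + 1) : ℝ) U) := by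
          rw [sum_add_distrib, mul_sum]
      _ ≤ (C * 2 ^ A / L + 1 / T) * N + U :=
          add_le_add (mul_le_mul_of_nonneg_left hsumA (by positivity)) htel
  -- junk terms: `N/T + 2T + 1 ≤ 8 √N ≤ 8 (2A)^A N / L`
  have hNT : (N : ℝ) / T ≤ Real.sqrt N := by
    rw [div_le_iff₀ hTpos]
    calc (N : ℝ) = Real.sqrt N * Real.sqrt N := (Real.mul_self_sqrt hNpos.le).symm
      _ ≤ Real.sqrt N * T := mul_le_mul_of_nonneg_left hTs (by positivity)
  have hjunk : 1 / T * N + U ≤ 8 * Real.sqrt N := by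
    rw [one_div, inv_mul_eq_div, hU]; linarith
  have hsqrtL : Real.sqrt N ≤ (2 * A) ^ A * N / L := by
    rw [le_div_iff₀ hLpos]
    have h := log_rpow_le_mul_sqrt hA hN1
    calc Real.sqrt N * L ≤ Real.sqrt N * ((2 * A) ^ A * Real.sqrt N) :=
          mul_le_mul_of_nonneg_left h (Real.sqrt_nonneg _)
      _ = (2 * A) ^ A * (Real.sqrt N * Real.sqrt N) := by ring
      _ = (2 * A) ^ A * N := by rw [Real.mul_self_sqrt hNpos.le]
  calc ‖∑ n ∈ Icc 1 N, f n‖ ≤ (C * 2 ^ A / L + 1 / T) * N + U := htotal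
    _ = C * 2 ^ A / L * N + (1 / T * N + U) := by ring
    _ ≤ C * 2 ^ A / L * N + 8 * ((2 * A) ^ A * N / L) := by
        linarith [mul_le_mul_of_nonneg_left hsqrtL (by norm_num : (0:ℝ) ≤ 8)]
    _ = (2 ^ A * C + 8 * (2 * A) ^ A) * N / Real.log N ^ A := by rw [hL]; ring

end Summit.Parity.GeneralizedHardyLittlewood.GreenTaoLevelTwoMNTwoDyadicToFull
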